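import Literature.InformationTheory.QuantumCodes.BivariateBicycleCodes
import Literature.InformationTheory.QuantumCodes.TwoBlockOrbitReduction
import Literature.InformationTheory.QuantumCodes.BBPinnedDistanceFlat
import Literature.InformationTheory.QuantumCodes.AutomorphismLabelAction
import Literature.InformationTheory.QuantumCodes.EvenWeightLogicals
import Literature.InformationTheory.QuantumCodes.BBEvenDistance
import Summits.Ventures.QEC.Census.CertBits
import Summits.Ventures.QEC.Census.BZAutBBFlat
import HarnessLib

/-!
# Translation orbits in FLAT indices for the `bz_aut` kernel path (qec PARTITION v2.5, item 12.BZT)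

The `[[144,12,12]]` Brouwer–Zimmermann-with-automorphisms certificate (kernel A, `bz_aut`) is replayed on
FLAT data: qubits `0 … 2ℓm−1` (`BB.Code.qubitIndex`: `(L,(a,b)) ↦ a·m+b`, `(R,(a,b)) ↦ ℓm+a·m+b`), rows
and logical operators as `Nat` words (`Census/CertBits.ofBits`).  The propositional assembly is generic
(type-07: `Census/BZAssembly.lean`, `BZAutAssembly.lean`, and `BZAutBBFlat.lean` = the flat translations
`BB.translateFlat t = qubitIndex ∘ translate t ∘ qubitIndex⁻¹` as row-map automorphisms of `HXFlat`/`HZFlat`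
+ the closer shape `BB.d_eq_of_bzAut_translateFlat_even`), built on type-12's
`Literature/…/AutomorphismLabelAction.lean` (label action `Ld *ᵥ (z ∘ σ⁻¹) = (Ld * (L.submatrix id σ⁻¹)ᵀ) *ᵥ (Ld *ᵥ z)`)
and `BBEvenDistance.lean` (parity).  This file adds what a WORD-LEVEL checker needs about those translations,
for every `QC(A, B)` and then for `BB.bb144`:

* `BB.translateIdx` + `BB.translateFlat_val` — `translateFlat` as `Nat` arithmetic:
  `((i/m + t₁) % ℓ)·m + (i % m + t₂) % m` on block `L` (`i < ℓm`), the same after removing the offset `ℓm`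
  on block `R`;
* `permWord f w n` — the word whose bit `f q` is bit `q` of `w` (`q < n`); `testBit_permWord`,
  `ofBits_permWord`: `ofBits n (permWord f w n) = ofBits n w ∘ σ⁻¹` when `f` agrees with the permutation `σ`
  — so `BB.ofBits_comp_translateFlat_symm`: the translate of the vector of `w` is the vector of
  `permWord (translateIdx ℓ m t₁ t₂) w (2ℓm)`;
* `BB.labelAction_apply_word` — the entries of the label-action matrix
  `ρ_t = Ld * (L.submatrix id (translateFlat t)⁻¹)ᵀ` as popcount parities
  `popc (lx i &&& permWord (translateIdx …) (lz j) n) mod 2` when `Ld i = ofBits n (lx i)`, `L j = ofBits n (lz j)`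
  — the `Nat` computation of column `j` of `ρ_t` (an alternative to `decide` on the matrix expression);
* parity on flat indices from ODD block weights (`BB.allOnes_mem_rowSpace_HXFlat/HZFlat`,
  `BB.even_hammingNorm_of_HXFlat_mulVec_eq_zero` / `…HZFlat…`), and METHOD-INDEPENDENT closer shapes for a flat
  code `D` with `D.HX = C.HXFlat`, `D.HZ = C.HZFlat`: `BB.d_eq_of_forall_lt_flat` (lower bound `W < |z|` on the
  non-trivial flat `Z`-logicals + flat witness of weight `W + 1` ⊢ `C.d = W + 1`) and
  `BB.d_eq_of_forall_lt_flat_of_odd` / `_of_isBBPoly` (`W` even, odd block weights, witness of weight `W + 2`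
  ⊢ `C.d = W + 2`) — whatever kernel (bz_aut, mitm, LRAT) supplies the lower bound;
* `bb144_odd_weight`, `bb144_even_hammingNorm_of_HXFlat`, `bb144_translateFlat_automorphism`,
  `bb144_d_eq_of_forall_lt_flat` (`10 < |z|` for all flat non-trivial `Z`-logicals + a weight-12 flat witness
  ⊢ `BB.bb144.d = 12`).

HONEST FRAMING: no distance VALUE is asserted; transport / parity lemmas for the 10.BZC checker (type-10) and
the data shards (search-1 / search-7).  Tier KERNEL, axioms standard, no `native_decide`.
-/

namespace Summit.Ventures.QEC.Census

open Matrix Literature.InformationTheory.QuantumCodes Literature.InformationTheory.QuantumCodes.BB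

/-! ## Flat translations of `QC(A, B)` -/

section FlatTranslate

variable {ℓ m : ℕ} [NeZero ℓ] [NeZero m]

/-- `translateFlat t (qubitIndex q) = qubitIndex (translate t q)` (type-07's `BB.translateFlat`,
`Census/BZAutBBFlat.lean`, is `qubitIndex ∘ translate t ∘ qubitIndex⁻¹`). -/
@[simp] theorem BB.translateFlat_qubitIndex (t : Mono ℓ m) (q : Mono ℓ m ⊕ Mono ℓ m) :
    BB.translateFlat t (BB.Code.qubitIndex q) = BB.Code.qubitIndex (BB.Code.translate t q) := by
  simp [BB.translateFlat]

/-- `qubitIndex⁻¹ (translateFlat t i) = translate t (qubitIndex⁻¹ i)`. -/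
@[simp] theorem BB.qubitIndex_symm_translateFlat (t : Mono ℓ m) (i : Fin (ℓ * m + ℓ * m)) :
    BB.Code.qubitIndex.symm (BB.translateFlat t i) = BB.Code.translate t (BB.Code.qubitIndex.symm i) := by
  simp [BB.translateFlat]

/-- Every flat `Z`-logical of `C.cssFlat` stays one under a flat translation (both directions; instance of
`CSSCode.zLogical_comp_equiv_symm_of_rowMap` with type-07's `BB.HXFlat_submatrix_translateFlat`). -/
theorem BB.zLogicalFlat_comp_translateFlat_symm (C : BB.Code ℓ m) (t : Mono ℓ m)
    {v : Fin (ℓ * m + ℓ * m) → ZMod 2} (hv : C.HXFlat *ᵥ v = 0 ∧ v ∉ rowSpace C.HZFlat) :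
    C.HXFlat *ᵥ (v ∘ (BB.translateFlat t).symm) = 0 ∧ v ∘ (BB.translateFlat t).symm ∉ rowSpace C.HZFlat :=
  C.cssFlat.zLogical_comp_equiv_symm_of_rowMap (BB.HXFlat_submatrix_translateFlat C t)
    (BB.HZFlat_submatrix_translateFlat C t) hv

/-- The flat translation as `Nat` arithmetic on a qubit index `i < 2ℓm`: block `L` (`i < ℓm`,
`i = a·m + b`) goes to `((a + t₁) mod ℓ)·m + (b + t₂) mod m`, block `R` likewise after removing the
offset `ℓm`. -/
def BB.translateIdx (ℓ m t₁ t₂ i : ℕ) : ℕ :=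
  if i < ℓ * m then ((i / m + t₁) % ℓ) * m + (i % m + t₂) % m
  else ℓ * m + ((((i - ℓ * m) / m + t₁) % ℓ) * m + ((i - ℓ * m) % m + t₂) % m)

omit [NeZero ℓ] in
/-- `(a·m + b) / m = a` and `(a·m + b) % m = b` for `b < m`. -/
private theorem divmod_aux (a : Fin ℓ) (b : Fin m) : (↑a * m + ↑b) / m = (a : ℕ) ∧ (↑a * m + ↑b) % m = (b : ℕ) := by
  have hm : 0 < m := Nat.pos_of_ne_zero (NeZero.ne m)
  constructor
  · rw [mul_comm, Nat.mul_add_div hm, Nat.div_eq_of_lt b.isLt, add_zero]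
  · rw [mul_comm, Nat.mul_add_mod, Nat.mod_eq_of_lt b.isLt]

/-- **`translateFlat` in `Nat` arithmetic**: `(translateFlat (t₁,t₂) i : ℕ) = translateIdx ℓ m t₁ t₂ i`. -/
theorem BB.translateFlat_val (t : Mono ℓ m) (i : Fin (ℓ * m + ℓ * m)) :
    ((BB.translateFlat t i : Fin (ℓ * m + ℓ * m)) : ℕ) = BB.translateIdx ℓ m t.1 t.2 i := by
  obtain ⟨q, rfl⟩ := BB.Code.qubitIndex.surjective i
  obtain ⟨t₁, t₂⟩ := t
  rw [BB.translateFlat_qubitIndex]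
  rcases q with ⟨a, b⟩ | ⟨a, b⟩
  · have hlt := BB.Code.qubitIndex_inl_val_lt (ℓ := ℓ) (m := m) (a, b)
    simp only [BB.Code.translate, Equiv.sumCongr_apply, Sum.map_inl, Equiv.coe_addRight, Prod.mk_add_mk,
      BB.Code.qubitIndex_inl_val, BB.translateIdx]
    rw [BB.Code.qubitIndex_inl_val] at hlt
    rw [if_pos hlt, (divmod_aux a b).1, (divmod_aux a b).2, Fin.val_add, Fin.val_add]
  · simp only [BB.Code.translate, Equiv.sumCongr_apply, Sum.map_inr, Equiv.coe_addRight, Prod.mk_add_mk,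
      BB.Code.qubitIndex_inr_val, BB.translateIdx]
    rw [if_neg (not_lt.2 (Nat.le_add_right _ _)), Nat.add_sub_cancel_left, (divmod_aux a b).1,
      (divmod_aux a b).2, Fin.val_add, Fin.val_add]

end FlatTranslate

/-! ## Moving the bits of a word along a permutation -/

section PermWord

/-- `permWord f w n`: the word whose bit `f q` is bit `q` of `w`, for `q < n` (bits of `w` at positions `≥ n`
are dropped). With `f = translateIdx ℓ m t₁ t₂` and `n = 2ℓm`: the translate of the vector `w`. -/
def permWord (f : ℕ → ℕ) (w : ℕ) : ℕ → ℕ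
  | 0 => 0
  | q + 1 => permWord f w q ^^^ (if w.testBit q then 2 ^ f q else 0)

/-- Bit `j` of `permWord f w n` is set iff `j = f q` for some `q < n` with bit `q` of `w` set — provided `f` is
injective below `n`. -/
theorem testBit_permWord (f : ℕ → ℕ) (w : ℕ) {n : ℕ}
    (hf : ∀ q₁ < n, ∀ q₂ < n, f q₁ = f q₂ → q₁ = q₂) (j : ℕ) :
    (permWord f w n).testBit j = true ↔ ∃ q < n, w.testBit q = true ∧ f q = j := by
  induction n with
  | zero => simp [permWord]
  | succ n ih =>
    have hf' : ∀ q₁ < n, ∀ q₂ < n, f q₁ = f q₂ → q₁ = q₂ :=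
      fun q₁ h₁ q₂ h₂ => hf q₁ (Nat.lt_succ_of_lt h₁) q₂ (Nat.lt_succ_of_lt h₂)
    have ih' := ih hf'
    rw [permWord, Nat.testBit_xor]
    by_cases hq : w.testBit n = true ∧ f n = j
    · -- bit `j` comes from position `n`; no earlier position maps to `j`
      have hprev : (permWord f w n).testBit j = false := by
        rw [← Bool.not_eq_true, ih']
        rintro ⟨q, hq', -, hfq⟩
        have := hf q (Nat.lt_succ_of_lt hq') n (Nat.lt_succ_self n) (hfq.trans hq.2.symm)
        omega
      rw [hprev, if_pos hq.1, Nat.testBit_two_pow]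
      simp only [hq.2, decide_true, Bool.false_xor]
      exact ⟨fun _ => ⟨n, Nat.lt_succ_self n, hq.1, hq.2⟩, fun _ => trivial⟩
    · have hlast : (if w.testBit n = true then 2 ^ f n else 0).testBit j = false := by
        by_cases hw : w.testBit n = true
        · rw [if_pos hw, Nat.testBit_two_pow]
          have : f n ≠ j := fun h => hq ⟨hw, h⟩
          simp [this]
        · rw [if_neg hw, Nat.zero_testBit]
      rw [hlast, Bool.xor_false, ih']
      constructor
      · rintro ⟨q, hq', hwq, hfq⟩
        exact ⟨q, Nat.lt_succ_of_lt hq', hwq, hfq⟩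
      · rintro ⟨q, hq', hwq, hfq⟩
        rcases Nat.lt_succ_iff_lt_or_eq.1 hq' with h | rfl
        · exact ⟨q, h, hwq, hfq⟩
        · exact absurd ⟨hwq, hfq⟩ hq

/-- **Word transport**: if `f` agrees with a permutation `σ` of `Fin n` on `{0,…,n−1}` then
`ofBits n (permWord f w n) = ofBits n w ∘ σ⁻¹` — the word `permWord f w n` represents the vector `w`
transported by `σ` (`v ↦ v ∘ σ⁻¹`, bit `q` moved to bit `σ q`). -/
theorem ofBits_permWord {n : ℕ} (σ : Fin n ≃ Fin n) (f : ℕ → ℕ) (hf : ∀ q : Fin n, f q = (σ q : ℕ))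
    (w : ℕ) : ofBits n (permWord f w n) = ofBits n w ∘ σ.symm := by
  have hinj : ∀ q₁ < n, ∀ q₂ < n, f q₁ = f q₂ → q₁ = q₂ := by
    intro q₁ h₁ q₂ h₂ h
    have h' : σ ⟨q₁, h₁⟩ = σ ⟨q₂, h₂⟩ := Fin.ext (by rw [← hf ⟨q₁, h₁⟩, ← hf ⟨q₂, h₂⟩, h])
    exact congrArg Fin.val (σ.injective h')
  funext j
  have key : (permWord f w n).testBit j = w.testBit (σ.symm j) := by
    rw [Bool.eq_iff_iff, testBit_permWord f w hinj]
    constructor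
    · rintro ⟨q, hq, hwq, hfq⟩
      have hσ : σ ⟨q, hq⟩ = j := Fin.ext (by rw [← hf ⟨q, hq⟩, hfq])
      rw [← hσ, Equiv.symm_apply_apply]
      exact hwq
    · intro h
      refine ⟨σ.symm j, (σ.symm j).isLt, h, ?_⟩
      rw [hf, Equiv.apply_symm_apply]
  simp only [ofBits, Function.comp_apply, key]


/-- **Label-action entries as popcount parities.** For logical operators given as words `lx i`, `lz j` on
`n = 2ℓm` qubits (`Ld i = ofBits n (lx i)`, `L j = ofBits n (lz j)`) and a translation `t`: the `(i, j)` entry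
of the label-action matrix `Ld * (L.submatrix id (translateFlat t)⁻¹)ᵀ` (`CSSCode.labelAction_apply`, type-12
p467242) is the parity of `popc (lx i &&& permWord (translateIdx ℓ m t₁ t₂) (lz j) n)` — the `Nat` computation
a checker performs for column `j` of `ρ_t`. -/
theorem BB.labelAction_apply_word {ℓ m : ℕ} [NeZero ℓ] [NeZero m] {κ : Type*}
    {Ld L : Matrix κ (Fin (ℓ * m + ℓ * m)) (ZMod 2)} {lx lz : κ → ℕ}
    (hLd : ∀ i, Ld i = ofBits (ℓ * m + ℓ * m) (lx i)) (hL : ∀ j, L j = ofBits (ℓ * m + ℓ * m) (lz j))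
    (t : Mono ℓ m) (i j : κ) :
    (Ld * (L.submatrix id (BB.translateFlat t).symm)ᵀ) i j =
      (popc (ℓ * m + ℓ * m)
        (lx i &&& permWord (BB.translateIdx ℓ m t.1 t.2) (lz j) (ℓ * m + ℓ * m)) : ZMod 2) := by
  rw [CSSCode.labelAction_apply, hLd, hL,
    ← ofBits_permWord (BB.translateFlat t) (BB.translateIdx ℓ m t.1 t.2) (fun q => (BB.translateFlat_val t q).symm),
    ofBits_dotProduct]

/-- The transported logical itself as a word: `ofBits n (lz j) ∘ (translateFlat t)⁻¹ = ofBits n (permWord …)`. -/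
theorem BB.ofBits_comp_translateFlat_symm {ℓ m : ℕ} [NeZero ℓ] [NeZero m] (t : Mono ℓ m) (w : ℕ) :
    ofBits (ℓ * m + ℓ * m) w ∘ (BB.translateFlat t).symm =
      ofBits (ℓ * m + ℓ * m) (permWord (BB.translateIdx ℓ m t.1 t.2) w (ℓ * m + ℓ * m)) :=
  (ofBits_permWord (BB.translateFlat t) (BB.translateIdx ℓ m t.1 t.2)
    (fun q => (BB.translateFlat_val t q).symm) w).symm

end PermWord

/-! ## Parity in flat indices and the closer shapes -/

section FlatParity

variable {ℓ m : ℕ} [NeZero ℓ] [NeZero m] (C : BB.Code ℓ m)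

/-- `𝟙 ∈ rs HXFlat` for odd `|A|`, `|B|` (flat form of `BB.Code.allOnes_mem_rowSpace_HX`). -/
theorem BB.allOnes_mem_rowSpace_HXFlat (hA : Odd (hammingNorm C.A)) (hB : Odd (hammingNorm C.B)) :
    (fun _ => (1 : ZMod 2)) ∈ rowSpace C.HXFlat :=
  (C.mem_rowSpace_HXFlat_iff _).2 (C.allOnes_mem_rowSpace_HX hA hB)

/-- `𝟙 ∈ rs HZFlat` for odd `|A|`, `|B|`. -/
theorem BB.allOnes_mem_rowSpace_HZFlat (hA : Odd (hammingNorm C.A)) (hB : Odd (hammingNorm C.B)) :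
    (fun _ => (1 : ZMod 2)) ∈ rowSpace C.HZFlat :=
  (C.mem_rowSpace_HZFlat_iff _).2 (C.allOnes_mem_rowSpace_HZ hA hB)

/-- **Flat EvenWeight**: for odd `|A|`, `|B|` every flat `z` with `HXFlat z = 0` has even weight. -/
theorem BB.even_hammingNorm_of_HXFlat_mulVec_eq_zero (hA : Odd (hammingNorm C.A)) (hB : Odd (hammingNorm C.B))
    {z : Fin (ℓ * m + ℓ * m) → ZMod 2} (hz : C.HXFlat *ᵥ z = 0) : Even (hammingNorm z) :=
  even_hammingNorm_of_mulVec_eq_zero (BB.allOnes_mem_rowSpace_HXFlat C hA hB) hz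

/-- `X` side: every flat `x` with `HZFlat x = 0` has even weight. -/
theorem BB.even_hammingNorm_of_HZFlat_mulVec_eq_zero (hA : Odd (hammingNorm C.A)) (hB : Odd (hammingNorm C.B))
    {x : Fin (ℓ * m + ℓ * m) → ZMod 2} (hx : C.HZFlat *ᵥ x = 0) : Even (hammingNorm x) :=
  even_hammingNorm_of_mulVec_eq_zero (BB.allOnes_mem_rowSpace_HZFlat C hA hB) hx

/-- **Closer shape (flat, no parity), for any flat presentation `D` of `QC(A, B)`** (`D.HX = C.HXFlat`,
`D.HZ = C.HZFlat`, e.g. the checker's `CSSCode.ofMatrices (rowMatrix n HX) (rowMatrix n HZ) _` after the index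
identities): a lower bound "`W < |z|` for every non-trivial `Z`-logical of `D`" (the conclusion of whatever
kernel — `forall_lt_of_bzAut`, mitm, LRAT) and a `Z`-witness of weight `W + 1` give `C.d = W + 1`
(Lemma 1 `d = d^Z` + type-05's `dZ_eq_of_flat`). -/
theorem BB.d_eq_of_forall_lt_flat {D : CSSCode (Fin (ℓ * m)) (Fin (ℓ * m)) (Fin (ℓ * m + ℓ * m))}
    (hX : D.HX = C.HXFlat) (hZ : D.HZ = C.HZFlat) {W : ℕ}
    (hlow : ∀ z, D.HX *ᵥ z = 0 → z ∉ D.rowSpZ → W < hammingNorm z)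
    {v : Fin (ℓ * m + ℓ * m) → ZMod 2} (hv : D.HX *ᵥ v = 0) (hv' : v ∉ D.rowSpZ)
    (hwt : hammingNorm v = W + 1) : C.d = W + 1 := by
  rw [C.d_eq_dZ, ← C.dZ_eq_of_flat hX hZ]
  exact D.dZ_eq_of_witness hv hv' hwt fun w hw hw' => hlow w hw hw'

/-- **Closer shape with parity**: odd `|A|`, `|B|`, `W` even, "`W < |z|` for every non-trivial `Z`-logical of
the flat presentation `D`" and a `Z`-witness of weight `W + 2` give `C.d = W + 2` — the certificate may stop
its enumeration at `wmax = W = d − 2`. -/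
theorem BB.d_eq_of_forall_lt_flat_of_odd {D : CSSCode (Fin (ℓ * m)) (Fin (ℓ * m)) (Fin (ℓ * m + ℓ * m))}
    (hX : D.HX = C.HXFlat) (hZ : D.HZ = C.HZFlat) (hA : Odd (hammingNorm C.A)) (hB : Odd (hammingNorm C.B))
    {W : ℕ} (hW : Even W) (hlow : ∀ z, D.HX *ᵥ z = 0 → z ∉ D.rowSpZ → W < hammingNorm z)
    {v : Fin (ℓ * m + ℓ * m) → ZMod 2} (hv : D.HX *ᵥ v = 0) (hv' : v ∉ D.rowSpZ)
    (hwt : hammingNorm v = W + 2) : C.d = W + 2 := by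
  rw [C.d_eq_dZ, ← C.dZ_eq_of_flat hX hZ]
  have h1 : (fun _ => (1 : ZMod 2)) ∈ D.rowSpX := by
    rw [CSSCode.rowSpX, hX]
    exact BB.allOnes_mem_rowSpace_HXFlat C hA hB
  refine D.dZ_eq_of_witness_of_even h1 hv hv' hwt fun w hw hw' => ?_
  have h2 := hlow w hw hw'
  obtain ⟨s, hs⟩ := hW
  omega

/-- The same with the printed side condition `IsBBPoly` discharging oddness. -/
theorem BB.d_eq_of_forall_lt_flat_of_isBBPoly {D : CSSCode (Fin (ℓ * m)) (Fin (ℓ * m)) (Fin (ℓ * m + ℓ * m))}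
    (hX : D.HX = C.HXFlat) (hZ : D.HZ = C.HZFlat) (hA : IsBBPoly C.A) (hB : IsBBPoly C.B) {W : ℕ} (hW : Even W)
    (hlow : ∀ z, D.HX *ᵥ z = 0 → z ∉ D.rowSpZ → W < hammingNorm z)
    {v : Fin (ℓ * m + ℓ * m) → ZMod 2} (hv : D.HX *ᵥ v = 0) (hv' : v ∉ D.rowSpZ)
    (hwt : hammingNorm v = W + 2) : C.d = W + 2 :=
  BB.d_eq_of_forall_lt_flat_of_odd C hX hZ (odd_hammingNorm_of_isBBPoly hA) (odd_hammingNorm_of_isBBPoly hB) hW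
    hlow hv hv' hwt

end FlatParity

/-! ## The `[[144,12,12]]` instances -/

section BB144

/-- `A = x³ + y + y²` and `B = y³ + x + x²` of the gross code have odd weight (three monomials each). -/
theorem bb144_odd_weight : Odd (hammingNorm BB.bb144.A) ∧ Odd (hammingNorm BB.bb144.B) :=
  ⟨odd_hammingNorm_of_isBBPoly isBBPoly_bb144.1, odd_hammingNorm_of_isBBPoly isBBPoly_bb144.2⟩

/-- Every flat `Z`-logical candidate of `BB.bb144` (`HXFlat z = 0`, `z : Fin 144 → 𝔽₂`) has even weight. -/
theorem bb144_even_hammingNorm_of_HXFlat {z : Fin (12 * 6 + 12 * 6) → ZMod 2}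
    (hz : BB.bb144.HXFlat *ᵥ z = 0) : Even (hammingNorm z) :=
  BB.even_hammingNorm_of_HXFlat_mulVec_eq_zero BB.bb144 bb144_odd_weight.1 bb144_odd_weight.2 hz

/-- **The `[[144,12,12]]` closer shape**: for any flat presentation `D` of `BB.bb144` (`D.HX = bb144.HXFlat`,
`D.HZ = bb144.HZFlat` — type-02's `rowMatrix_bb144HX/HZ`, `Census/BB/BB144Rank.lean`), "`10 < |z|` for every
non-trivial `Z`-logical of `D`" (a kernel replay with `wmax = 10`) and a `Z`-witness of weight `12` give
`BB.bb144.d = 12`. -/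
theorem bb144_d_eq_of_forall_lt_flat {D : CSSCode (Fin (12 * 6)) (Fin (12 * 6)) (Fin (12 * 6 + 12 * 6))}
    (hX : D.HX = BB.bb144.HXFlat) (hZ : D.HZ = BB.bb144.HZFlat)
    (hlow : ∀ z, D.HX *ᵥ z = 0 → z ∉ D.rowSpZ → 10 < hammingNorm z)
    {v : Fin (12 * 6 + 12 * 6) → ZMod 2} (hv : D.HX *ᵥ v = 0) (hv' : v ∉ D.rowSpZ) (hwt : hammingNorm v = 12) :
    BB.bb144.d = 12 :=
  BB.d_eq_of_forall_lt_flat_of_odd BB.bb144 hX hZ bb144_odd_weight.1 bb144_odd_weight.2 (W := 10) ⟨5, rfl⟩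
    hlow hv hv' hwt

/-- The 72 translations of `ℤ₁₂ × ℤ₆` are row-map automorphisms of `bb144.HXFlat` and `bb144.HZFlat`
(hypotheses `hσX`, `hσZ` of `forall_lt_of_bzAut BB.bb144.cssFlat` for ANY list `τ` of translations). -/
theorem bb144_translateFlat_automorphism (t : Mono 12 6) :
    BB.bb144.HXFlat.submatrix (BB.checkTranslateFlat t) (BB.translateFlat t) = BB.bb144.HXFlat ∧
      BB.bb144.HZFlat.submatrix (BB.checkTranslateFlat t) (BB.translateFlat t) = BB.bb144.HZFlat :=
  ⟨BB.HXFlat_submatrix_translateFlat BB.bb144 t, BB.HZFlat_submatrix_translateFlat BB.bb144 t⟩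

end BB144

/-! ## The transport hypotheses of a `bz_aut` closer, discharged for flat translations (appended) -/

section Transport

variable {ℓ m : ℕ} [NeZero ℓ] [NeZero m]

/-- **All four transport facts a `bz_aut` closer asks of an automorphism** (type-10's `bzAut_lower_sound`,
hypothesis `hφ`; type-07's `forall_lt_of_bzAut`), for the flat translation `φ_t z := z ∘ (translateFlat t)⁻¹` of
`QC(A, B)`: it maps non-trivial flat `Z`-logicals to non-trivial flat `Z`-logicals, preserves the Hamming weight,
and acts on labels by `ρ_t = LdM * (LM.submatrix id (translateFlat t)⁻¹)ᵀ` — given the label rows `LdM` lie in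
`ker HZFlat` and the expansion property of lemma L1 (`hexp`, e.g. from `CSSCode.sub_label_vecMul_mem_rowSpZ` /
`Census/CertLogical.exists_coeffs_of_ker`). For a flat presentation `D` with `D.HX = C.HXFlat`, `D.HZ = C.HZFlat`
rewrite with those identities. -/
theorem BB.bzAut_transport_translateFlat (C : BB.Code ℓ m) {κ : Type*} [Fintype κ]
    {LdM LM : Matrix κ (Fin (ℓ * m + ℓ * m)) (ZMod 2)}
    (hdual : ∀ i, C.HZFlat *ᵥ LdM i = 0)
    (hexp : ∀ z, C.HXFlat *ᵥ z = 0 → z - (LdM *ᵥ z) ᵥ* LM ∈ rowSpace C.HZFlat)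
    (t : Mono ℓ m) (z : Fin (ℓ * m + ℓ * m) → ZMod 2) (hz : C.HXFlat *ᵥ z = 0)
    (hz' : z ∉ rowSpace C.HZFlat) :
    C.HXFlat *ᵥ (z ∘ (BB.translateFlat t).symm) = 0 ∧ z ∘ (BB.translateFlat t).symm ∉ rowSpace C.HZFlat ∧
      hammingNorm (z ∘ (BB.translateFlat t).symm) = hammingNorm z ∧
      LdM *ᵥ (z ∘ (BB.translateFlat t).symm) =
        (LdM * (LM.submatrix id (BB.translateFlat t).symm)ᵀ) *ᵥ (LdM *ᵥ z) := by
  have h12 := BB.zLogicalFlat_comp_translateFlat_symm C t ⟨hz, hz'⟩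
  exact ⟨h12.1, h12.2, hammingNorm_comp_equiv z (BB.translateFlat t),
    C.cssFlat.label_comp_equiv_symm (LX := LdM) (LZ := LM) hdual hexp (BB.HZFlat_submatrix_translateFlat C t) hz⟩

end Transport

end Summit.Ventures.QEC.Census
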